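import Mathlib.Analysis.SpecialFunctions.PolarCoord
import Mathlib.Analysis.SpecialFunctions.Complex.Arg
import Mathlib.MeasureTheory.Integral.Prod
import Mathlib.Analysis.InnerProductSpace.PiL2
import Mathlib.MeasureTheory.Measure.Haar.InnerProductSpace
import HarnessLib

/-!
# Planar integrals as iterated polar integrals

Fubini in polar coordinates on the plane: for an integrable `f : ℝ × ℝ → E`,

  `∫ f = ∫_{ρ ∈ (0,∞)} ∫_{θ ∈ (−π,π)} ρ • f(ρ cos θ, ρ sin θ) dθ dρ`

(`integral_eq_integral_Ioi_integral_Ioo_polar`), together with the integrability of the polar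
integrand on `polarCoord.target = (0,∞) × (−π,π)` (`integrableOn_polarCoord_target`, from
Mathlib's change-of-variables criterion `integrableOn_image_iff_integrableOn_abs_det_fderiv_smul`
and `hasFDerivAt_polarCoord_symm`, `det = ρ`), the a.e. integrability of the angular sections
(`ae_integrableOn_Ioo_polar`), and the same statements on `EuclideanSpace ℝ (Fin 2)` transported
along the volume-preserving identification with `ℝ × ℝ`
(`integral_euclidean_eq_integral_Ioi_integral_Ioo_polar`). Also the polar angle of a planar vector
(`exists_apply_eq_norm_mul_cos_sin`: `x₀ = ‖x‖ cos α`, `x₁ = ‖x‖ sin α`, via `Complex.arg`).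
Mathlib has the non-iterated change of variables `integral_comp_polarCoord_symm`; the iterated
form with its integrability bookkeeping is what computations of convolution integrals in the plane
consume (e.g. the Biot–Savart velocity of a mode-two vorticity, Gallay–Wayne 2006, Prop. 3.1).
Everything is proved; no definitions. [folklore]
-/

noncomputable section

open Set Filter MeasureTheory MeasureTheory.Measure Real

namespace Literature.Analysis.Calculus

variable {E : Type*} [NormedAddCommGroup E] [NormedSpace ℝ E]

/-! ### The plane `ℝ × ℝ` -/

/-- **Integrability of the polar integrand.** If `f` is integrable on `ℝ × ℝ` then
`(ρ, θ) ↦ ρ • f(ρ cos θ, ρ sin θ)` is integrable on `polarCoord.target = (0,∞) × (−π,π)`. [folklore] -/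
theorem integrableOn_polarCoord_target {f : ℝ × ℝ → E} (hf : Integrable f) :
    IntegrableOn (fun p : ℝ × ℝ => p.1 • f (polarCoord.symm p)) polarCoord.target := by
  have h1 : IntegrableOn f (polarCoord.symm '' polarCoord.target) := hf.integrableOn
  have hinj : InjOn polarCoord.symm polarCoord.target := polarCoord.symm.injOn
  rw [integrableOn_image_iff_integrableOn_abs_det_fderiv_smul volume
    polarCoord.open_target.measurableSet
    (fun p _ => (hasFDerivAt_polarCoord_symm p).hasFDerivWithinAt) hinj] at h1
  refine h1.congr_fun (fun p hp => ?_) polarCoord.open_target.measurableSet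
  simp only
  rw [det_fderivPolarCoordSymm, abs_of_pos hp.1]

/-- The restriction of planar Lebesgue measure to `(0,∞) × (−π,π)` is the product of the
restrictions. [folklore] -/
theorem volume_restrict_polarCoord_target :
    (volume : Measure (ℝ × ℝ)).restrict polarCoord.target =
      ((volume : Measure ℝ).restrict (Ioi 0)).prod ((volume : Measure ℝ).restrict (Ioo (-π) π)) :=
  (Measure.prod_restrict _ _).symm

/-- The polar integrand is integrable for the product of the restricted measures. [folklore] -/
theorem integrable_polar_prod {f : ℝ × ℝ → E} (hf : Integrable f) :
    Integrable (fun p : ℝ × ℝ => p.1 • f (p.1 * cos p.2, p.1 * sin p.2))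
      (((volume : Measure ℝ).restrict (Ioi 0)).prod
        ((volume : Measure ℝ).restrict (Ioo (-π) π))) := by
  have hint := integrableOn_polarCoord_target hf
  rw [IntegrableOn, volume_restrict_polarCoord_target] at hint
  simpa only [polarCoord_symm_apply] using hint

/-- **Fubini in polar coordinates on `ℝ × ℝ`.** For integrable `f`,
`∫ f = ∫_{ρ>0} ∫_{θ ∈ (−π,π)} ρ • f(ρ cos θ, ρ sin θ) dθ dρ`. [folklore] -/
theorem integral_eq_integral_Ioi_integral_Ioo_polar {f : ℝ × ℝ → E} (hf : Integrable f) :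
    ∫ p, f p = ∫ ρ in Ioi (0 : ℝ), ∫ θ in Ioo (-π) π, ρ • f (ρ * cos θ, ρ * sin θ) := by
  rw [← integral_comp_polarCoord_symm f, volume_restrict_polarCoord_target]
  simp only [polarCoord_symm_apply]
  rw [integral_prod _ (integrable_polar_prod hf)]

/-- **Integrability of the inner polar integrals.** [folklore] -/
theorem integrableOn_integral_Ioo_polar {f : ℝ × ℝ → E} (hf : Integrable f) :
    IntegrableOn (fun ρ => ∫ θ in Ioo (-π) π, ρ • f (ρ * cos θ, ρ * sin θ)) (Ioi 0) :=
  (integrable_polar_prod hf).integral_prod_left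

/-- **A.e. integrability of the angular sections** `θ ↦ ρ • f(ρ cos θ, ρ sin θ)` on `(−π,π)`,
for a.e. `ρ > 0`. [folklore] -/
theorem ae_integrableOn_Ioo_polar {f : ℝ × ℝ → E} (hf : Integrable f) :
    ∀ᵐ ρ ∂(volume : Measure ℝ).restrict (Ioi 0),
      IntegrableOn (fun θ => ρ • f (ρ * cos θ, ρ * sin θ)) (Ioo (-π) π) :=
  (integrable_polar_prod hf).prod_right_ae

/-! ### The plane `EuclideanSpace ℝ (Fin 2)` -/

/-- The coordinate map `ℝ × ℝ → EuclideanSpace ℝ (Fin 2)`, `q ↦ (q.1, q.2)`, is volume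
preserving. [folklore] -/
theorem measurePreserving_toLp_fin_two :
    MeasurePreserving (fun q : ℝ × ℝ => (WithLp.toLp 2 ![q.1, q.2] : EuclideanSpace ℝ (Fin 2)))
      volume volume := by
  set T : EuclideanSpace ℝ (Fin 2) ≃ᵐ ℝ × ℝ :=
    (MeasurableEquiv.toLp 2 (Fin 2 → ℝ)).symm.trans MeasurableEquiv.finTwoArrow with hT
  have hTmp : MeasurePreserving T volume volume :=
    (EuclideanSpace.volume_preserving_symm_measurableEquiv_toLp (Fin 2)).trans
      (volume_preserving_finTwoArrow ℝ)
  have hfun : (fun q : ℝ × ℝ => (WithLp.toLp 2 ![q.1, q.2] : EuclideanSpace ℝ (Fin 2))) = T.symm :=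
    funext fun q => rfl
  rw [hfun]
  exact hTmp.symm

/-- The coordinate map `ℝ × ℝ → EuclideanSpace ℝ (Fin 2)` is a measurable embedding (indeed a
measurable equivalence). [folklore] -/
theorem measurableEmbedding_toLp_fin_two :
    MeasurableEmbedding (fun q : ℝ × ℝ => (WithLp.toLp 2 ![q.1, q.2] : EuclideanSpace ℝ (Fin 2))) := by
  set T : EuclideanSpace ℝ (Fin 2) ≃ᵐ ℝ × ℝ :=
    (MeasurableEquiv.toLp 2 (Fin 2 → ℝ)).symm.trans MeasurableEquiv.finTwoArrow with hT
  have hfun : (fun q : ℝ × ℝ => (WithLp.toLp 2 ![q.1, q.2] : EuclideanSpace ℝ (Fin 2))) = T.symm :=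
    funext fun q => rfl
  rw [hfun]
  exact T.symm.measurableEmbedding

/-- Transport of integrals from `EuclideanSpace ℝ (Fin 2)` to `ℝ × ℝ`. [folklore] -/
theorem integral_euclidean_eq_integral_prod (F : EuclideanSpace ℝ (Fin 2) → E) :
    ∫ z, F z = ∫ q : ℝ × ℝ, F (WithLp.toLp 2 ![q.1, q.2]) :=
  (measurePreserving_toLp_fin_two.integral_comp measurableEmbedding_toLp_fin_two F).symm

omit [NormedSpace ℝ E] in
/-- Transport of integrability from `EuclideanSpace ℝ (Fin 2)` to `ℝ × ℝ`. [folklore] -/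
theorem integrable_comp_toLp_fin_two_iff (F : EuclideanSpace ℝ (Fin 2) → E) :
    Integrable (fun q : ℝ × ℝ => F (WithLp.toLp 2 ![q.1, q.2])) ↔ Integrable F :=
  measurePreserving_toLp_fin_two.integrable_comp_emb measurableEmbedding_toLp_fin_two

/-- **Fubini in polar coordinates on `EuclideanSpace ℝ (Fin 2)`.** For integrable `F`,
`∫ F = ∫_{ρ>0} ∫_{θ∈(−π,π)} ρ • F(ρ cos θ, ρ sin θ) dθ dρ`. [folklore] -/
theorem integral_euclidean_eq_integral_Ioi_integral_Ioo_polar {F : EuclideanSpace ℝ (Fin 2) → E}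
    (hF : Integrable F) :
    ∫ z, F z = ∫ ρ in Ioi (0 : ℝ), ∫ θ in Ioo (-π) π,
      ρ • F (WithLp.toLp 2 ![ρ * cos θ, ρ * sin θ]) := by
  rw [integral_euclidean_eq_integral_prod,
    integral_eq_integral_Ioi_integral_Ioo_polar ((integrable_comp_toLp_fin_two_iff F).2 hF)]

/-- The norm of a coordinate vector of the plane. [folklore] -/
theorem norm_toLp_fin_two (a b : ℝ) :
    ‖(WithLp.toLp 2 ![a, b] : EuclideanSpace ℝ (Fin 2))‖ = √(a ^ 2 + b ^ 2) := by
  rw [EuclideanSpace.norm_eq, Fin.sum_univ_two]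
  simp [sq_abs]

/-- The norm of the polar point `(ρ cos θ, ρ sin θ)` is `ρ` (`0 ≤ ρ`). [folklore] -/
theorem norm_toLp_polar {ρ : ℝ} (hρ : 0 ≤ ρ) (θ : ℝ) :
    ‖(WithLp.toLp 2 ![ρ * cos θ, ρ * sin θ] : EuclideanSpace ℝ (Fin 2))‖ = ρ := by
  rw [norm_toLp_fin_two]
  have : (ρ * cos θ) ^ 2 + (ρ * sin θ) ^ 2 = ρ ^ 2 := by nlinarith [sin_sq_add_cos_sq θ]
  rw [this, sqrt_sq hρ]

/-- **The polar angle of a planar vector**: `x₀ = ‖x‖ cos α`, `x₁ = ‖x‖ sin α` for some `α`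
(the argument of `x₀ + i x₁`; any `α` if `x = 0`). [folklore] -/
theorem exists_apply_eq_norm_mul_cos_sin (x : EuclideanSpace ℝ (Fin 2)) :
    ∃ α : ℝ, x 0 = ‖x‖ * cos α ∧ x 1 = ‖x‖ * sin α := by
  have hn : ‖x‖ = √(x 0 ^ 2 + x 1 ^ 2) := by
    rw [EuclideanSpace.norm_eq, Fin.sum_univ_two]
    simp [sq_abs]
  by_cases hx : x = 0
  · refine ⟨0, ?_, ?_⟩ <;> simp [hx]
  set z : ℂ := ⟨x 0, x 1⟩ with hz
  have hzn : ‖z‖ = ‖x‖ := by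
    rw [hn, Complex.norm_def, Complex.normSq_apply]
    congr 1
    simp only [hz]
    ring
  have hz0 : z ≠ 0 := by
    intro h
    have h0 : ‖x‖ = 0 := by rw [← hzn, h, norm_zero]
    exact hx (norm_eq_zero.1 h0)
  have hpos : 0 < ‖x‖ := norm_pos_iff.2 hx
  refine ⟨Complex.arg z, ?_, ?_⟩
  · rw [Complex.cos_arg hz0, hzn]
    field_simp
    rfl
  · rw [Complex.sin_arg, hzn]
    field_simp
    rfl

end Literature.Analysis.Calculus
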